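import Summits.Ventures.CertifiedManyBodySolver.Theorems.TcThermcert1GcFusedExponential
import Mathlib
import HarnessLib

/-!
# Factorisation property of the two-fugacity generalised Gibbs factor (K2 groundwork, part 3)

Helper file for route `TcThermcert1`, crux `ThermalStiffnessCeilingU8b10_le_1o8` (item `stmt-Ventures-26381`), line
`Cruxes/ThermalStiffnessCeilingU8b10_le_1o8/Lines/zerofree_corridor.lean` v9, registered stub K2 `stub_gcHighTempAnalytic`, step S3 of
`Cruxes/…/STUB-PLAN-stub_gcHighTempAnalytic.md`.

The polymer representation of a generalised Gibbs factor `c ↦ Zc(c)` (tree: `Literature…HubbardPolymerRepresentation`, cell pub-hubbard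
`Bounds/CouplingPolymerGas`) rests on exactly ONE analytic input, Ueltschi's factorisation property
`Zc(c₁ + c₂) · Zc(0) = Zc(c₁) · Zc(c₂)` for couplings living on bonds inside disjoint site sets (`HubbardBondAlgebra.Zc_add_mul_Zc_zero`);
everything after it (bond weights, Möbius inversion, pushforward to site polymers) is combinatorics on the function `c ↦ Zc(c)`.
This file proves that input for the TWO-FUGACITY generalised Gibbs factor of part 1,
`Zc₂(c) = tr exp( −β V_Λ(U,0) + Σ_x (log z · n_{x↑} + log w · n_{x↓}) + Σ_b c_b T_b )` (complex `β, U`, fugacities `z, w`):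

* §1 the log-fugacity one-site operator `F_A(z,w) = Σ_{x∈A} (log z · n_{x↑} + log w · n_{x↓})`: it is an even local operator of `A`
  (`sum_logFugacity_mem`), additive over disjoint site sets (`sum_logFugacity_univ_eq_add_add`), and on `A = Λ` it is the diagonal
  `diag(#↑s · log z + #↓s · log w)` of part 1 (`sum_logFugacity_univ_eq_diagonal`);
* §2 **the factorisation property** `Zc₂(c₁ + c₂) · Zc₂(0) = Zc₂(c₁) · Zc₂(c₂)` (`trace_exp_twoFugacity_add_mul`, pattern of
  `Zc_add_mul_Zc_zero`: three commuting even local exponents, `HubbardBondAlgebra.trace_exp_add_add_mul`), stated for any function `T`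
  that agrees with `Zc₂` (`hT`) so that a later port may instantiate its own definition, and the same with the exponent written through the
  diagonal of part 1 (`trace_exp_twoFugacity_add_mul'`), which is the form produced by `gcTwist_trace_eq_trace_exp`.

[cite: Ueltschi1999, §2.1 (factorization property of quantum interactions), §2.3] Finite-dimensional linear algebra; no physics claim —
nothing about superconductivity in the Hubbard model is proved by anything in this file. No definitions; no `sorry`.
-/

noncomputable section

namespace Summit.Ventures.CertifiedManyBodySolver.Theorems.TcThermcert1.ZeroFreeCorridor

open Matrix Finset Complex
open Literature.MathematicalPhysics.QuantumLattice

variable {Λ : Type*} [LinearOrder Λ] [Fintype Λ]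

/-! ## §1 The log-fugacity one-site operator -/

/-- `F_A(z,w) = Σ_{x∈A} (log z · n_{x↑} + log w · n_{x↓})` is an even local operator of any `B ⊇ A`. -/
theorem sum_logFugacity_mem (z w : ℂ) {A B : Finset Λ} (h : A ⊆ B) :
    (∑ x ∈ A, (Complex.log z • numberOp x 0 + Complex.log w • numberOp x 1)) ∈ carEvenSubalgebra (orbs B) :=
  Subalgebra.sum_mem _ fun _ hx => Subalgebra.add_mem _ (Subalgebra.smul_mem _ (numberOp_mem (h hx) 0) _)
    (Subalgebra.smul_mem _ (numberOp_mem (h hx) 1) _)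

/-- The local exponent `−β V_A(U,0) + F_A(z,w)` is an even local operator of any `B ⊇ A`. -/
theorem twoFugacityLocal_mem (β U z w : ℂ) {A B : Finset Λ} (h : A ⊆ B) :
    -(β • onSiteSum U 0 A) + (∑ x ∈ A, (Complex.log z • numberOp x 0 + Complex.log w • numberOp x 1)) ∈
      carEvenSubalgebra (orbs B) :=
  Subalgebra.add_mem _ (Subalgebra.neg_mem _ (Subalgebra.smul_mem _ (onSiteSum_mem U 0 h) _)) (sum_logFugacity_mem z w h)

/-- Additivity of `F` over the decomposition `Λ = A₁ ⊔ A₂ ⊔ (A₁ ∪ A₂)ᶜ`. -/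
theorem sum_logFugacity_univ_eq_add_add (z w : ℂ) {A₁ A₂ : Finset Λ} (hA : Disjoint A₁ A₂) :
    (∑ x ∈ (univ : Finset Λ), (Complex.log z • numberOp x 0 + Complex.log w • numberOp x 1)) =
      (∑ x ∈ A₁, (Complex.log z • numberOp x 0 + Complex.log w • numberOp x 1)) +
        (∑ x ∈ A₂, (Complex.log z • numberOp x 0 + Complex.log w • numberOp x 1)) +
        ∑ x ∈ (A₁ ∪ A₂)ᶜ, (Complex.log z • numberOp x 0 + Complex.log w • numberOp x 1) := by
  rw [← Finset.union_compl (A₁ ∪ A₂), Finset.sum_union disjoint_compl_right, Finset.sum_union hA]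

/-- Additivity of `V_A(U,μ)` over the same decomposition (`onSiteSum_union`). -/
theorem onSiteSum_univ_eq_add_add (U μ : ℂ) {A₁ A₂ : Finset Λ} (hA : Disjoint A₁ A₂) :
    onSiteSum U μ (univ : Finset Λ) = onSiteSum U μ A₁ + onSiteSum U μ A₂ + onSiteSum U μ (A₁ ∪ A₂)ᶜ := by
  rw [← Finset.union_compl (A₁ ∪ A₂), onSiteSum_union U μ disjoint_compl_right, onSiteSum_union U μ hA]

/-- `F_Λ(z,w)` is the diagonal `diag(#↑s · log z + #↓s · log w)` (canonical instances). -/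
theorem sum_logFugacity_univ_eq_diagonal_aux (z w : ℂ) :
    (∑ x ∈ (univ : Finset Λ), (Complex.log z • numberOp x 0 + Complex.log w • numberOp x 1)) =
      diagonal (fun s : Finset (Orb Λ) =>
        ((upPart s).card : ℂ) * Complex.log z + ((downPart s).card : ℂ) * Complex.log w) := by
  have hn : ∀ (x : Λ) (σ : Fin 2),
      numberOp x σ = diagonal (fun s : Finset (Orb Λ) => if orb x σ ∈ s then (1 : ℂ) else 0) := fun x σ => by
    rw [← numberAt_orb, numberAt_eq_diagonal]
  ext s t
  simp only [Matrix.sum_apply, Matrix.add_apply, Matrix.smul_apply, hn, diagonal_apply, smul_eq_mul]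
  by_cases hst : s = t
  · subst hst
    simp only [if_true, mul_ite, mul_one, mul_zero, Finset.sum_add_distrib]
    rw [← Finset.sum_filter, ← Finset.sum_filter, Finset.sum_const, Finset.sum_const, nsmul_eq_mul, nsmul_eq_mul]
    rfl
  · simp [hst]

/-- `F_Λ(z,w) = diag(#↑s · log z + #↓s · log w)` for an arbitrary `DecidableEq` instance on configurations. -/
theorem sum_logFugacity_univ_eq_diagonal {inst : DecidableEq (Finset (Orb Λ))} (z w : ℂ) :
    (∑ x ∈ (univ : Finset Λ), (Complex.log z • numberOp x 0 + Complex.log w • numberOp x 1)) =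
      @diagonal _ ℂ inst _ (fun s : Finset (Orb Λ) =>
        ((upPart s).card : ℂ) * Complex.log z + ((downPart s).card : ℂ) * Complex.log w) := by
  convert sum_logFugacity_univ_eq_diagonal_aux (Λ := Λ) z w using 2

/-! ## §2 The factorisation property -/

/-- Cross-multiplication bookkeeping. -/
private theorem cross_mul_bookkeeping {a d b₁ b₂ x₁ x₂ y₁ y₂ τ N : ℂ} (hN : N ≠ 0) (f12 : a * N = x₁ * x₂ * τ)
    (f0 : d * N = y₁ * y₂ * τ) (f1 : b₁ * N = x₁ * y₂ * τ) (f2 : b₂ * N = y₁ * x₂ * τ) : a * d = b₁ * b₂ := by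
  apply mul_right_cancel₀ (mul_ne_zero hN hN)
  calc a * d * (N * N) = (a * N) * (d * N) := by ring
    _ = (x₁ * x₂ * τ) * (y₁ * y₂ * τ) := by rw [f12, f0]
    _ = (x₁ * y₂ * τ) * (y₁ * x₂ * τ) := by ring
    _ = (b₁ * N) * (b₂ * N) := by rw [f1, f2]
    _ = b₁ * b₂ * (N * N) := by ring

/-- **Factorisation property of the two-fugacity generalised Gibbs factor** (Ueltschi's factorization property, §2.1, in trace form):
if the couplings `c₁`, `c₂` live on bonds inside disjoint site sets `A₁`, `A₂`, then
`Zc₂(c₁ + c₂) · Zc₂(0) = Zc₂(c₁) · Zc₂(c₂)` for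
`Zc₂(c) = tr exp(−β V_Λ(U,0) + F_Λ(z,w) + Σ_b c_b T_b)` — stated for any `T` agreeing with `Zc₂` (`hT`). -/
theorem trace_exp_twoFugacity_add_mul (β U z w : ℂ) {A₁ A₂ : Finset Λ} (hA : Disjoint A₁ A₂) {c₁ c₂ : Bond Λ → ℂ}
    (hc₁ : ∀ b, c₁ b ≠ 0 → b.1 ∈ A₁ ∧ b.2.1 ∈ A₁) (hc₂ : ∀ b, c₂ b ≠ 0 → b.1 ∈ A₂ ∧ b.2.1 ∈ A₂)
    (T : (Bond Λ → ℂ) → ℂ)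
    (hT : ∀ c, T c = (NormedSpace.exp (-(β • onSiteSum U 0 (univ : Finset Λ)) +
      (∑ x ∈ (univ : Finset Λ), (Complex.log z • numberOp x 0 + Complex.log w • numberOp x 1)) + hopSum c)).trace) :
    T (c₁ + c₂) * T 0 = T c₁ * T c₂ := by
  have h13 : Disjoint A₁ (A₁ ∪ A₂)ᶜ := Finset.disjoint_left.2 fun x hx hx' =>
    (Finset.mem_compl.1 hx') (Finset.mem_union_left _ hx)
  have h23 : Disjoint A₂ (A₁ ∪ A₂)ᶜ := Finset.disjoint_left.2 fun x hx hx' =>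
    (Finset.mem_compl.1 hx') (Finset.mem_union_right _ hx)
  have d12 := disjoint_orbs hA
  have d13 := disjoint_orbs h13
  have d23 := disjoint_orbs h23
  have hV := onSiteSum_univ_eq_add_add U (0 : ℂ) hA
  have hF := sum_logFugacity_univ_eq_add_add z w hA
  -- the three local exponents
  have mW : ∀ A : Finset Λ, -(β • onSiteSum U 0 A) +
      (∑ x ∈ A, (Complex.log z • numberOp x 0 + Complex.log w • numberOp x 1)) ∈ carEvenSubalgebra (orbs A) :=
    fun A => twoFugacityLocal_mem β U z w subset_rfl
  have m1 : -(β • onSiteSum U 0 A₁) + (∑ x ∈ A₁, (Complex.log z • numberOp x 0 + Complex.log w • numberOp x 1)) +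
      hopSum c₁ ∈ carEvenSubalgebra (orbs A₁) := Subalgebra.add_mem _ (mW A₁) (hopSum_mem hc₁)
  have m2 : -(β • onSiteSum U 0 A₂) + (∑ x ∈ A₂, (Complex.log z • numberOp x 0 + Complex.log w • numberOp x 1)) +
      hopSum c₂ ∈ carEvenSubalgebra (orbs A₂) := Subalgebra.add_mem _ (mW A₂) (hopSum_mem hc₂)
  have key : ∀ P₁ P₂ : Matrix (Finset (Orb Λ)) (Finset (Orb Λ)) ℂ, P₁ ∈ carEvenSubalgebra (orbs A₁) →
      P₂ ∈ carEvenSubalgebra (orbs A₂) →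
      (NormedSpace.exp (P₁ + P₂ + (-(β • onSiteSum U 0 (A₁ ∪ A₂)ᶜ) +
        ∑ x ∈ (A₁ ∪ A₂)ᶜ, (Complex.log z • numberOp x 0 + Complex.log w • numberOp x 1)))).trace *
          (2 ^ Fintype.card (Orb Λ)) ^ 2 =
        (NormedSpace.exp P₁).trace * (NormedSpace.exp P₂).trace *
          (NormedSpace.exp (-(β • onSiteSum U 0 (A₁ ∪ A₂)ᶜ) +
            ∑ x ∈ (A₁ ∪ A₂)ᶜ, (Complex.log z • numberOp x 0 + Complex.log w • numberOp x 1))).trace :=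
    fun P₁ P₂ h₁ h₂ => trace_exp_add_add_mul h₁ h₂ (mW _) d12 d13 d23
  -- the four Gibbs factors
  have e12 : T (c₁ + c₂) = (NormedSpace.exp
      ((-(β • onSiteSum U 0 A₁) + (∑ x ∈ A₁, (Complex.log z • numberOp x 0 + Complex.log w • numberOp x 1)) + hopSum c₁) +
      (-(β • onSiteSum U 0 A₂) + (∑ x ∈ A₂, (Complex.log z • numberOp x 0 + Complex.log w • numberOp x 1)) + hopSum c₂) +
      (-(β • onSiteSum U 0 (A₁ ∪ A₂)ᶜ) +
        ∑ x ∈ (A₁ ∪ A₂)ᶜ, (Complex.log z • numberOp x 0 + Complex.log w • numberOp x 1)))).trace := by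
    rw [hT, hV, hF, hopSum_add]; congr 2; simp only [smul_add, neg_add]; abel
  have e0 : T 0 = (NormedSpace.exp
      ((-(β • onSiteSum U 0 A₁) + (∑ x ∈ A₁, (Complex.log z • numberOp x 0 + Complex.log w • numberOp x 1))) +
      (-(β • onSiteSum U 0 A₂) + (∑ x ∈ A₂, (Complex.log z • numberOp x 0 + Complex.log w • numberOp x 1))) +
      (-(β • onSiteSum U 0 (A₁ ∪ A₂)ᶜ) +
        ∑ x ∈ (A₁ ∪ A₂)ᶜ, (Complex.log z • numberOp x 0 + Complex.log w • numberOp x 1)))).trace := by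
    rw [hT, hV, hF, hopSum_zero, add_zero]; congr 2; simp only [smul_add, neg_add]; abel
  have e1 : T c₁ = (NormedSpace.exp
      ((-(β • onSiteSum U 0 A₁) + (∑ x ∈ A₁, (Complex.log z • numberOp x 0 + Complex.log w • numberOp x 1)) + hopSum c₁) +
      (-(β • onSiteSum U 0 A₂) + (∑ x ∈ A₂, (Complex.log z • numberOp x 0 + Complex.log w • numberOp x 1))) +
      (-(β • onSiteSum U 0 (A₁ ∪ A₂)ᶜ) +
        ∑ x ∈ (A₁ ∪ A₂)ᶜ, (Complex.log z • numberOp x 0 + Complex.log w • numberOp x 1)))).trace := by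
    rw [hT, hV, hF]; congr 2; simp only [smul_add, neg_add]; abel
  have e2 : T c₂ = (NormedSpace.exp
      ((-(β • onSiteSum U 0 A₁) + (∑ x ∈ A₁, (Complex.log z • numberOp x 0 + Complex.log w • numberOp x 1))) +
      (-(β • onSiteSum U 0 A₂) + (∑ x ∈ A₂, (Complex.log z • numberOp x 0 + Complex.log w • numberOp x 1)) + hopSum c₂) +
      (-(β • onSiteSum U 0 (A₁ ∪ A₂)ᶜ) +
        ∑ x ∈ (A₁ ∪ A₂)ᶜ, (Complex.log z • numberOp x 0 + Complex.log w • numberOp x 1)))).trace := by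
    rw [hT, hV, hF]; congr 2; simp only [smul_add, neg_add]; abel
  rw [e12, e0, e1, e2]
  exact cross_mul_bookkeeping (pow_ne_zero _ (pow_ne_zero _ two_ne_zero)) (key _ _ m1 m2) (key _ _ (mW A₁) (mW A₂))
    (key _ _ m1 (mW A₂)) (key _ _ (mW A₁) m2)

/-- **Factorisation property, diagonal form.** The same statement for `T` agreeing with the exponent written through the diagonal
`diag(#↑s · log z + #↓s · log w)` of part 1 (any `DecidableEq` instance on configurations) — the form delivered by
`gcTwist_trace_eq_trace_exp` for K2's twisted torus trace (with `c₁ := β • ttFluxCoupling L 1 t′ θ` restricted to sub-boxes). -/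
theorem trace_exp_twoFugacity_add_mul' {inst : DecidableEq (Finset (Orb Λ))} (β U z w : ℂ) {A₁ A₂ : Finset Λ} (hA : Disjoint A₁ A₂)
    {c₁ c₂ : Bond Λ → ℂ} (hc₁ : ∀ b, c₁ b ≠ 0 → b.1 ∈ A₁ ∧ b.2.1 ∈ A₁)
    (hc₂ : ∀ b, c₂ b ≠ 0 → b.1 ∈ A₂ ∧ b.2.1 ∈ A₂)
    (T : (Bond Λ → ℂ) → ℂ)
    (hT : ∀ c, T c = (NormedSpace.exp (-(β • onSiteSum U 0 (univ : Finset Λ)) +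
      (@diagonal _ ℂ inst _ fun s : Finset (Orb Λ) =>
        ((upPart s).card : ℂ) * Complex.log z + ((downPart s).card : ℂ) * Complex.log w) + hopSum c)).trace) :
    T (c₁ + c₂) * T 0 = T c₁ * T c₂ :=
  trace_exp_twoFugacity_add_mul β U z w hA hc₁ hc₂ T fun c => by rw [hT, ← sum_logFugacity_univ_eq_diagonal]; congr!

/-- **The coupling-free value** `Zc₂(0) = z₂^{#Λ}`, `z₂ = 1 + z + w + z w e^{−βU}`, in the `F_Λ` form (from part 1's
`trace_exp_neg_onSiteSum_add_logFugacity`), for `z, w ≠ 0`. -/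
theorem trace_exp_twoFugacity_zero {z w : ℂ} (β U : ℂ) (hz : z ≠ 0) (hw : w ≠ 0) :
    (NormedSpace.exp (-(β • onSiteSum U 0 (univ : Finset Λ)) +
      (∑ x ∈ (univ : Finset Λ), (Complex.log z • numberOp x 0 + Complex.log w • numberOp x 1)) +
        hopSum (0 : Bond Λ → ℂ))).trace = (1 + z + w + z * w * cexp (-(β * U))) ^ Fintype.card Λ := by
  rw [hopSum_zero, add_zero, sum_logFugacity_univ_eq_diagonal_aux, trace_exp_neg_onSiteSum_add_logFugacity β U hz hw]

end Summit.Ventures.CertifiedManyBodySolver.Theorems.TcThermcert1.ZeroFreeCorridor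

end
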